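import Summits.CriticalPhenomena.PercolationContinuityZ3.Theorems.PercNearOneGluingNoHeavyLowerTailMonotonePolarizedStrongHarris
import HarnessLib

/-!
# `NoHeavyLowerTail` (crux stmt-CriticalPhenomena-4575), abstract sunflower cubic at LAW level: the PENCIL FORMS — the one-step (mixed
# Bernstein) coefficient of `6H` splits as `2(λ_B + α) = 2(λ_A + β)`, and the Gladkov parts `α = ⟨u,∇(a·AG)(m)⟩`, `β = ⟨u,∇(b·AG)(m)⟩`
# are NONNEGATIVE for every pair of comparable product measures (Gladkov + monotone polarized strong Harris)

Support file (seat `prim-ineq-gen-2` gen 29; `--supports stmt-CriticalPhenomena-4575`).  Nothing is asserted about the crux; no `sorry`, no named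
facts, standard axioms.  Memo: run/shared/lean/prim/prim-ineq-gen-2/SHARP-FORM-GEN29.md §6.  Companion (to be landed once the farm has the olean of
gen 28's `…SunflowerLawOneStep`): `…SunflowerLawPencilSplit` — `triH u m m = mixedH u m`, the typed dichotomy `LawPolarizedC1` and the reductions
`LawPolarizedC1 → LawMixedNonneg → H-COMB`.

SETTING.  Cell vectors `m = (b, c₁, c₂, c₃, a) : Fin 5 → ℝ` (index `0` bottom, `1,2,3` petals, `4` top/core), as in gen 28's `LawOneStep.cellVec`
(restated here as `LawPencil.cells` to keep this file independent of that module).  The lane's static split (prim-ineq-prove-1 (C1-law)) is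
`H = LA + b·AG = LB + a·AG`, `AG = ab − e₂(c)`, `LA = a·AG − e₃`, `LB = b·AG − e₃`.  Polarizing along `u`:
`mixedH u m := 2⟨u, ∇H(m)⟩` (= gen 28's `triH u m m`, the closed form `LawOneStep.triH_mixed_eq`), `mixedLA u m = ⟨u,∇LA(m)⟩`,
`mixedLB u m = ⟨u,∇LB(m)⟩`, `mixedTop u m = ⟨u,∇(a·AG)(m)⟩ = u₄·AG(m) + m₄·POL(u,m)`, `mixedBot u m = ⟨u,∇(b·AG)(m)⟩ = u₀·AG(m) + m₀·POL(u,m)`,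
`POL(u,m) = u₄m₀ + u₀m₄ − Σ_{i≠j} uᵢmⱼ` (the polarized Gladkov form).

RESULTS [this work]:
* identities `mixedH_eq_split_A : mixedH u m = 2(mixedLA u m + mixedBot u m)`, `mixedH_eq_split_B : … = 2(mixedLB u m + mixedTop u m)`,
  `mixedLA_self : mixedLA m m = 3·LA(m)`, `mixedLB_self`, `polAG_comm`;
* **`mixedTop_cells_nonneg`, `mixedBot_cells_nonneg`**: for a three-petal sunflower of up-sets of a finite cube and two parameter vectors
  `p' ≤ p` (coordinatewise), BOTH `⟨m_p, ∇(a·AG)(m_{p'})⟩ ≥ 0` and `⟨m_{p'}, ∇(a·AG)(m_p)⟩ ≥ 0` (and the `b·AG` versions): `AG(m) ≥ 0` is Gladkov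
  (`prodBernoulli_strongHarris_sunflower_three`), `POL(m_p, m_{p'}) ≥ 0` is the tree's `prodBernoulli_polarized_strongHarris_sunflower_three`.
  With `p = q[e↦1]`, `p' = q[e↦0]` (`update_zero_le_update_one`) these are the section laws of a coordinate pencil: the cubics `t ↦ a(m_t)·AG(m_t)`
  and `t ↦ b(m_t)·AG(m_t)` are Bernstein-positive on every pencil (`mixedTop_sections_nonneg`, `mixedBot_sections_nonneg`);
* `mixedH_cells_nonneg_of_mixedLA_nonneg` / `…_of_mixedLB_nonneg`: for `p' ≤ p` and either order of the pair, `mixedH ≥ 0` as soon as `mixedLA ≥ 0`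
  OR `mixedLB ≥ 0` — the one-step inequality of gen 28 holds wherever the polarized (C1) dichotomy does; `lawH_nonneg_of_LA_or_LB`: the static case.
-/

noncomputable section

namespace Summit.CriticalPhenomena.PercolationContinuityZ3.Theorems.SunflowerPartition

namespace LawPencil

open MeasureTheory
open Literature.Probability.LatticeModels Literature.Probability.Percolation

variable {ι : Type*}

/-! ## The polarized pieces (polynomials in two cell vectors `u`, `m : Fin 5 → ℝ`) -/

/-- Gladkov's form `AG(m) = ab − (c₁c₂ + c₁c₃ + c₂c₃)`. [this work] -/
def AGform (m : Fin 5 → ℝ) : ℝ := m 4 * m 0 - (m 1 * m 2 + m 1 * m 3 + m 2 * m 3)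

/-- The POLARIZED Gladkov form `POL(u,m) = u₄m₀ + u₀m₄ − Σ_{i≠j} uᵢ mⱼ` (twice the symmetric bilinear form of `AG`). [this work] -/
def polAG (u m : Fin 5 → ℝ) : ℝ :=
  u 4 * m 0 + u 0 * m 4 - (u 1 * m 2 + u 1 * m 3 + u 2 * m 1 + u 2 * m 3 + u 3 * m 1 + u 3 * m 2)

/-- `2⟨u, ∇H(m)⟩` written out — the closed form of gen 28's `triH u m m` (`LawOneStep.triH_mixed_eq`). [this work] -/
def mixedH (u m : Fin 5 → ℝ) : ℝ :=
  2 * (u 4 * (2 * m 4 * m 0 + m 0 ^ 2 - (m 1 * m 2 + m 1 * m 3 + m 2 * m 3))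
      + u 0 * (2 * m 4 * m 0 + m 4 ^ 2 - (m 1 * m 2 + m 1 * m 3 + m 2 * m 3))
      - u 1 * ((m 4 + m 0) * (m 2 + m 3) + m 2 * m 3)
      - u 2 * ((m 4 + m 0) * (m 1 + m 3) + m 1 * m 3)
      - u 3 * ((m 4 + m 0) * (m 1 + m 2) + m 1 * m 2))

/-- `⟨u, ∇LA(m)⟩` for `LA = a·AG − e₃ = a²b − a e₂ − e₃` (the mixed Bernstein coefficient of `LA`, times `3` on the diagonal). [this work] -/
def mixedLA (u m : Fin 5 → ℝ) : ℝ :=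
  u 4 * (2 * m 4 * m 0 - (m 1 * m 2 + m 1 * m 3 + m 2 * m 3)) + u 0 * m 4 ^ 2
    - u 1 * (m 4 * (m 2 + m 3) + m 2 * m 3) - u 2 * (m 4 * (m 1 + m 3) + m 1 * m 3) - u 3 * (m 4 * (m 1 + m 2) + m 1 * m 2)

/-- `⟨u, ∇LB(m)⟩` for `LB = b·AG − e₃ = ab² − b e₂ − e₃`. [this work] -/
def mixedLB (u m : Fin 5 → ℝ) : ℝ :=
  u 4 * m 0 ^ 2 + u 0 * (2 * m 4 * m 0 - (m 1 * m 2 + m 1 * m 3 + m 2 * m 3))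
    - u 1 * (m 0 * (m 2 + m 3) + m 2 * m 3) - u 2 * (m 0 * (m 1 + m 3) + m 1 * m 3) - u 3 * (m 0 * (m 1 + m 2) + m 1 * m 2)

/-- `⟨u, ∇(a·AG)(m)⟩ = u₄·AG(m) + m₄·POL(u,m)`. [this work] -/
def mixedTop (u m : Fin 5 → ℝ) : ℝ := u 4 * AGform m + m 4 * polAG u m

/-- `⟨u, ∇(b·AG)(m)⟩ = u₀·AG(m) + m₀·POL(u,m)`. [this work] -/
def mixedBot (u m : Fin 5 → ℝ) : ℝ := u 0 * AGform m + m 0 * polAG u m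

/-- **Pencil split, A-form**: `2⟨u,∇H(m)⟩ = 2(⟨u,∇LA(m)⟩ + ⟨u,∇(b·AG)(m)⟩)`. [this work] -/
theorem mixedH_eq_split_A (u m : Fin 5 → ℝ) : mixedH u m = 2 * (mixedLA u m + mixedBot u m) := by
  simp only [mixedH, mixedLA, mixedBot, AGform, polAG]
  ring

/-- **Pencil split, B-form**: `2⟨u,∇H(m)⟩ = 2(⟨u,∇LB(m)⟩ + ⟨u,∇(a·AG)(m)⟩)`. [this work] -/
theorem mixedH_eq_split_B (u m : Fin 5 → ℝ) : mixedH u m = 2 * (mixedLB u m + mixedTop u m) := by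
  simp only [mixedH, mixedLB, mixedTop, AGform, polAG]
  ring

/-- On the diagonal `mixedH m m = 6H(m) = 6[(a+b)(ab − e₂) − e₃]`. [this work] -/
theorem mixedH_self (m : Fin 5 → ℝ) :
    mixedH m m = 6 * ((m 4 + m 0) * (m 4 * m 0 - (m 1 * m 2 + m 1 * m 3 + m 2 * m 3)) - m 1 * m 2 * m 3) := by
  simp only [mixedH]; ring

/-- On the diagonal `mixedLA m m = 3·LA(m) = 3(a·AG − e₃)`. [this work] -/
theorem mixedLA_self (m : Fin 5 → ℝ) : mixedLA m m = 3 * (m 4 * AGform m - m 1 * m 2 * m 3) := by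
  simp only [mixedLA, AGform]; ring

/-- On the diagonal `mixedLB m m = 3·LB(m) = 3(b·AG − e₃)`. [this work] -/
theorem mixedLB_self (m : Fin 5 → ℝ) : mixedLB m m = 3 * (m 0 * AGform m - m 1 * m 2 * m 3) := by
  simp only [mixedLB, AGform]; ring

/-- The polarized Gladkov form is symmetric. [this work] -/
theorem polAG_comm (u m : Fin 5 → ℝ) : polAG u m = polAG m u := by
  simp only [polAG]; ring

/-- `POL(m,m) = 2·AG(m)`. [this work] -/
theorem polAG_self (m : Fin 5 → ℝ) : polAG m m = 2 * AGform m := by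
  simp only [polAG, AGform]; ring

/-- `mixedTop` is nonnegative as soon as `u₄, m₄ ≥ 0`, `AG(m) ≥ 0`, `POL(u,m) ≥ 0`. [this work] -/
theorem mixedTop_nonneg {u m : Fin 5 → ℝ} (hu : 0 ≤ u 4) (hm : 0 ≤ m 4) (hAG : 0 ≤ AGform m) (hpol : 0 ≤ polAG u m) :
    0 ≤ mixedTop u m :=
  add_nonneg (mul_nonneg hu hAG) (mul_nonneg hm hpol)

/-- `mixedBot` is nonnegative as soon as `u₀, m₀ ≥ 0`, `AG(m) ≥ 0`, `POL(u,m) ≥ 0`. [this work] -/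
theorem mixedBot_nonneg {u m : Fin 5 → ℝ} (hu : 0 ≤ u 0) (hm : 0 ≤ m 0) (hAG : 0 ≤ AGform m) (hpol : 0 ≤ polAG u m) :
    0 ≤ mixedBot u m :=
  add_nonneg (mul_nonneg hu hAG) (mul_nonneg hm hpol)

/-! ## Cell vectors of a sunflower under comparable product measures -/

/-- The cell vector `(b, c₁, c₂, c₃, a)` of the sunflower `(E₁, E₂, E₃; A)` under `prodBernoulli q` (= gen 28's `LawOneStep.cellVec`,
restated). [this work] -/
def cells (q : ι → unitInterval) (E₁ E₂ E₃ A : Set (Set ι)) : Fin 5 → ℝ :=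
  ![(prodBernoulli q).real (E₁ ∪ E₂ ∪ E₃)ᶜ, (prodBernoulli q).real (E₁ \ A), (prodBernoulli q).real (E₂ \ A),
    (prodBernoulli q).real (E₃ \ A), (prodBernoulli q).real A]

/-- Components of the cell vector (index `0` = bottom). [this work] -/
theorem cells_apply_zero (q : ι → unitInterval) (E₁ E₂ E₃ A : Set (Set ι)) :
    cells q E₁ E₂ E₃ A 0 = (prodBernoulli q).real (E₁ ∪ E₂ ∪ E₃)ᶜ := rfl

/-- Components of the cell vector (index `1` = first petal). [this work] -/
theorem cells_apply_one (q : ι → unitInterval) (E₁ E₂ E₃ A : Set (Set ι)) :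
    cells q E₁ E₂ E₃ A 1 = (prodBernoulli q).real (E₁ \ A) := rfl

/-- Components of the cell vector (index `2` = second petal). [this work] -/
theorem cells_apply_two (q : ι → unitInterval) (E₁ E₂ E₃ A : Set (Set ι)) :
    cells q E₁ E₂ E₃ A 2 = (prodBernoulli q).real (E₂ \ A) := rfl

/-- Components of the cell vector (index `3` = third petal). [this work] -/
theorem cells_apply_three (q : ι → unitInterval) (E₁ E₂ E₃ A : Set (Set ι)) :
    cells q E₁ E₂ E₃ A 3 = (prodBernoulli q).real (E₃ \ A) := rfl

/-- Components of the cell vector (index `4` = top/core). [this work] -/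
theorem cells_apply_four (q : ι → unitInterval) (E₁ E₂ E₃ A : Set (Set ι)) :
    cells q E₁ E₂ E₃ A 4 = (prodBernoulli q).real A := rfl

section Finite

variable [Fintype ι]

/-- Gladkov's inequality for the cell vector: `AG(cells q) ≥ 0`. [cite: Gladkov2024StrongFKG, Thm. 2.1 (k = 3), via the tree lemma] -/
theorem AGform_cells_nonneg (q : ι → unitInterval) {A E₁ E₂ E₃ : Set (Set ι)} (h₁ : IsUpperSet E₁) (h₂ : IsUpperSet E₂)
    (h₃ : IsUpperSet E₃) (h12 : E₁ ∩ E₂ = A) (h13 : E₁ ∩ E₃ = A) (h23 : E₂ ∩ E₃ = A) :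
    0 ≤ AGform (cells q E₁ E₂ E₃ A) := by
  have h := prodBernoulli_strongHarris_sunflower_three q h₁ h₂ h₃ h12 h13 h23
  simp only [AGform, cells_apply_zero, cells_apply_one, cells_apply_two, cells_apply_three, cells_apply_four]
  linarith

/-- **Polarized Gladkov for comparable parameters**: `POL(cells p, cells p') ≥ 0` whenever `p' ≤ p` coordinatewise — the tree's monotone
polarized strong Harris inequality in the language of cell vectors. [this work] -/
theorem polAG_cells_nonneg (p p' : ι → unitInterval) (hpp : ∀ e, (p' e : ℝ) ≤ p e) {A E₁ E₂ E₃ : Set (Set ι)}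
    (h₁ : IsUpperSet E₁) (h₂ : IsUpperSet E₂) (h₃ : IsUpperSet E₃) (h12 : E₁ ∩ E₂ = A) (h13 : E₁ ∩ E₃ = A) (h23 : E₂ ∩ E₃ = A) :
    0 ≤ polAG (cells p E₁ E₂ E₃ A) (cells p' E₁ E₂ E₃ A) := by
  have h := prodBernoulli_polarized_strongHarris_sunflower_three p p' hpp h₁ h₂ h₃ h12 h13 h23
  simp only [polAG, cells_apply_zero, cells_apply_one, cells_apply_two, cells_apply_three, cells_apply_four]
  linarith

/-- **`⟨m_p, ∇(a·AG)(m_{p'})⟩ ≥ 0` and `⟨m_{p'}, ∇(a·AG)(m_p)⟩ ≥ 0` for `p' ≤ p`.** [this work] -/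
theorem mixedTop_cells_nonneg (p p' : ι → unitInterval) (hpp : ∀ e, (p' e : ℝ) ≤ p e) {A E₁ E₂ E₃ : Set (Set ι)}
    (h₁ : IsUpperSet E₁) (h₂ : IsUpperSet E₂) (h₃ : IsUpperSet E₃) (h12 : E₁ ∩ E₂ = A) (h13 : E₁ ∩ E₃ = A) (h23 : E₂ ∩ E₃ = A) :
    0 ≤ mixedTop (cells p E₁ E₂ E₃ A) (cells p' E₁ E₂ E₃ A) ∧ 0 ≤ mixedTop (cells p' E₁ E₂ E₃ A) (cells p E₁ E₂ E₃ A) := by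
  have hpol := polAG_cells_nonneg p p' hpp h₁ h₂ h₃ h12 h13 h23
  have hpol' : 0 ≤ polAG (cells p' E₁ E₂ E₃ A) (cells p E₁ E₂ E₃ A) := by rwa [polAG_comm]
  have hAG := AGform_cells_nonneg p h₁ h₂ h₃ h12 h13 h23
  have hAG' := AGform_cells_nonneg p' h₁ h₂ h₃ h12 h13 h23
  have ha : 0 ≤ cells p E₁ E₂ E₃ A 4 := by rw [cells_apply_four]; exact measureReal_nonneg
  have ha' : 0 ≤ cells p' E₁ E₂ E₃ A 4 := by rw [cells_apply_four]; exact measureReal_nonneg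
  exact ⟨mixedTop_nonneg ha ha' hAG' hpol, mixedTop_nonneg ha' ha hAG hpol'⟩

/-- **`⟨m_p, ∇(b·AG)(m_{p'})⟩ ≥ 0` and `⟨m_{p'}, ∇(b·AG)(m_p)⟩ ≥ 0` for `p' ≤ p`.** [this work] -/
theorem mixedBot_cells_nonneg (p p' : ι → unitInterval) (hpp : ∀ e, (p' e : ℝ) ≤ p e) {A E₁ E₂ E₃ : Set (Set ι)}
    (h₁ : IsUpperSet E₁) (h₂ : IsUpperSet E₂) (h₃ : IsUpperSet E₃) (h12 : E₁ ∩ E₂ = A) (h13 : E₁ ∩ E₃ = A) (h23 : E₂ ∩ E₃ = A) :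
    0 ≤ mixedBot (cells p E₁ E₂ E₃ A) (cells p' E₁ E₂ E₃ A) ∧ 0 ≤ mixedBot (cells p' E₁ E₂ E₃ A) (cells p E₁ E₂ E₃ A) := by
  have hpol := polAG_cells_nonneg p p' hpp h₁ h₂ h₃ h12 h13 h23
  have hpol' : 0 ≤ polAG (cells p' E₁ E₂ E₃ A) (cells p E₁ E₂ E₃ A) := by rwa [polAG_comm]
  have hAG := AGform_cells_nonneg p h₁ h₂ h₃ h12 h13 h23
  have hAG' := AGform_cells_nonneg p' h₁ h₂ h₃ h12 h13 h23
  have hb : 0 ≤ cells p E₁ E₂ E₃ A 0 := by rw [cells_apply_zero]; exact measureReal_nonneg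
  have hb' : 0 ≤ cells p' E₁ E₂ E₃ A 0 := by rw [cells_apply_zero]; exact measureReal_nonneg
  exact ⟨mixedBot_nonneg hb hb' hAG' hpol, mixedBot_nonneg hb' hb hAG hpol'⟩

/-- **One-step positivity from the A-branch**: for `p' ≤ p` (either order of the pair as `(u, m)`), `mixedH u m ≥ 0` as soon as
`mixedLA u m ≥ 0`. [this work] -/
theorem mixedH_cells_nonneg_of_mixedLA_nonneg (p p' : ι → unitInterval) (hpp : ∀ e, (p' e : ℝ) ≤ p e) {A E₁ E₂ E₃ : Set (Set ι)}
    (h₁ : IsUpperSet E₁) (h₂ : IsUpperSet E₂) (h₃ : IsUpperSet E₃) (h12 : E₁ ∩ E₂ = A) (h13 : E₁ ∩ E₃ = A) (h23 : E₂ ∩ E₃ = A) :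
    (0 ≤ mixedLA (cells p E₁ E₂ E₃ A) (cells p' E₁ E₂ E₃ A) → 0 ≤ mixedH (cells p E₁ E₂ E₃ A) (cells p' E₁ E₂ E₃ A)) ∧
    (0 ≤ mixedLA (cells p' E₁ E₂ E₃ A) (cells p E₁ E₂ E₃ A) → 0 ≤ mixedH (cells p' E₁ E₂ E₃ A) (cells p E₁ E₂ E₃ A)) := by
  obtain ⟨hb, hb'⟩ := mixedBot_cells_nonneg p p' hpp h₁ h₂ h₃ h12 h13 h23
  refine ⟨fun hLA => ?_, fun hLA => ?_⟩
  · rw [mixedH_eq_split_A]; linarith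
  · rw [mixedH_eq_split_A]; linarith

/-- **One-step positivity from the B-branch**: for `p' ≤ p` (either order), `mixedH u m ≥ 0` as soon as `mixedLB u m ≥ 0`. [this work] -/
theorem mixedH_cells_nonneg_of_mixedLB_nonneg (p p' : ι → unitInterval) (hpp : ∀ e, (p' e : ℝ) ≤ p e) {A E₁ E₂ E₃ : Set (Set ι)}
    (h₁ : IsUpperSet E₁) (h₂ : IsUpperSet E₂) (h₃ : IsUpperSet E₃) (h12 : E₁ ∩ E₂ = A) (h13 : E₁ ∩ E₃ = A) (h23 : E₂ ∩ E₃ = A) :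
    (0 ≤ mixedLB (cells p E₁ E₂ E₃ A) (cells p' E₁ E₂ E₃ A) → 0 ≤ mixedH (cells p E₁ E₂ E₃ A) (cells p' E₁ E₂ E₃ A)) ∧
    (0 ≤ mixedLB (cells p' E₁ E₂ E₃ A) (cells p E₁ E₂ E₃ A) → 0 ≤ mixedH (cells p' E₁ E₂ E₃ A) (cells p E₁ E₂ E₃ A)) := by
  obtain ⟨ht, ht'⟩ := mixedTop_cells_nonneg p p' hpp h₁ h₂ h₃ h12 h13 h23
  refine ⟨fun hLB => ?_, fun hLB => ?_⟩
  · rw [mixedH_eq_split_B]; linarith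
  · rw [mixedH_eq_split_B]; linarith

end Finite

/-! ## Coordinate pencils: `p' = q[e↦0] ≤ p = q[e↦1]` -/

section Pencil

variable [DecidableEq ι]

/-- The two section parameters of a coordinate pencil are ordered: `q[e↦0] ≤ q[e↦1]` coordinatewise. [this work] -/
theorem update_zero_le_update_one (q : ι → unitInterval) (e x : ι) :
    ((Function.update q e 0 x : unitInterval) : ℝ) ≤ (Function.update q e 1 x : unitInterval) := by
  by_cases hx : x = e
  · subst hx
    simp
  · simp only [Function.update_of_ne hx, le_refl]

variable [Fintype ι]

/-- **The cubic `t ↦ a(m_t)·AG(m_t)` is Bernstein-positive on every coordinate pencil**: both mixed coefficients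
`⟨m₁, ∇(a·AG)(m₀)⟩`, `⟨m₀, ∇(a·AG)(m₁)⟩` are `≥ 0` (`m₀, m₁` the cell vectors under `q[e↦0]`, `q[e↦1]`). [this work] -/
theorem mixedTop_sections_nonneg (q : ι → unitInterval) {A E₁ E₂ E₃ : Set (Set ι)} (h₁ : IsUpperSet E₁) (h₂ : IsUpperSet E₂)
    (h₃ : IsUpperSet E₃) (h12 : E₁ ∩ E₂ = A) (h13 : E₁ ∩ E₃ = A) (h23 : E₂ ∩ E₃ = A) (e : ι) :
    0 ≤ mixedTop (cells (Function.update q e 1) E₁ E₂ E₃ A) (cells (Function.update q e 0) E₁ E₂ E₃ A) ∧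
    0 ≤ mixedTop (cells (Function.update q e 0) E₁ E₂ E₃ A) (cells (Function.update q e 1) E₁ E₂ E₃ A) :=
  mixedTop_cells_nonneg _ _ (update_zero_le_update_one q e) h₁ h₂ h₃ h12 h13 h23

/-- **The cubic `t ↦ b(m_t)·AG(m_t)` is Bernstein-positive on every coordinate pencil.** [this work] -/
theorem mixedBot_sections_nonneg (q : ι → unitInterval) {A E₁ E₂ E₃ : Set (Set ι)} (h₁ : IsUpperSet E₁) (h₂ : IsUpperSet E₂)
    (h₃ : IsUpperSet E₃) (h12 : E₁ ∩ E₂ = A) (h13 : E₁ ∩ E₃ = A) (h23 : E₂ ∩ E₃ = A) (e : ι) :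
    0 ≤ mixedBot (cells (Function.update q e 1) E₁ E₂ E₃ A) (cells (Function.update q e 0) E₁ E₂ E₃ A) ∧
    0 ≤ mixedBot (cells (Function.update q e 0) E₁ E₂ E₃ A) (cells (Function.update q e 1) E₁ E₂ E₃ A) :=
  mixedBot_cells_nonneg _ _ (update_zero_le_update_one q e) h₁ h₂ h₃ h12 h13 h23

end Pencil

/-! ## The static case: (C1-law) at one parameter implies H-COMB there -/

/-- **Static companion**: at a single parameter `p`, the dichotomy (C1-law) `LA ≥ 0 ∨ LB ≥ 0` implies H-COMB, because
`H = LA + b·AG = LB + a·AG` and `AG ≥ 0` (Gladkov). [this work] -/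
theorem lawH_nonneg_of_LA_or_LB [Fintype ι] (p : ι → unitInterval) {A E₁ E₂ E₃ : Set (Set ι)}
    (h₁ : IsUpperSet E₁) (h₂ : IsUpperSet E₂) (h₃ : IsUpperSet E₃)
    (h12 : E₁ ∩ E₂ = A) (h13 : E₁ ∩ E₃ = A) (h23 : E₂ ∩ E₃ = A)
    (hC1 : (prodBernoulli p).real (E₁ \ A) * (prodBernoulli p).real (E₂ \ A) * (prodBernoulli p).real (E₃ \ A) ≤
        (prodBernoulli p).real A * ((prodBernoulli p).real A * (prodBernoulli p).real (E₁ ∪ E₂ ∪ E₃)ᶜ -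
          ((prodBernoulli p).real (E₁ \ A) * (prodBernoulli p).real (E₂ \ A) +
            (prodBernoulli p).real (E₁ \ A) * (prodBernoulli p).real (E₃ \ A) +
            (prodBernoulli p).real (E₂ \ A) * (prodBernoulli p).real (E₃ \ A))) ∨
      (prodBernoulli p).real (E₁ \ A) * (prodBernoulli p).real (E₂ \ A) * (prodBernoulli p).real (E₃ \ A) ≤
        (prodBernoulli p).real (E₁ ∪ E₂ ∪ E₃)ᶜ * ((prodBernoulli p).real A * (prodBernoulli p).real (E₁ ∪ E₂ ∪ E₃)ᶜ -
          ((prodBernoulli p).real (E₁ \ A) * (prodBernoulli p).real (E₂ \ A) +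
            (prodBernoulli p).real (E₁ \ A) * (prodBernoulli p).real (E₃ \ A) +
            (prodBernoulli p).real (E₂ \ A) * (prodBernoulli p).real (E₃ \ A)))) :
    0 ≤ ((prodBernoulli p).real A + (prodBernoulli p).real (E₁ ∪ E₂ ∪ E₃)ᶜ) *
        ((prodBernoulli p).real A * (prodBernoulli p).real (E₁ ∪ E₂ ∪ E₃)ᶜ -
          ((prodBernoulli p).real (E₁ \ A) * (prodBernoulli p).real (E₂ \ A) +
            (prodBernoulli p).real (E₁ \ A) * (prodBernoulli p).real (E₃ \ A) +
            (prodBernoulli p).real (E₂ \ A) * (prodBernoulli p).real (E₃ \ A))) -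
      (prodBernoulli p).real (E₁ \ A) * (prodBernoulli p).real (E₂ \ A) * (prodBernoulli p).real (E₃ \ A) := by
  have hAG := prodBernoulli_strongHarris_sunflower_three p h₁ h₂ h₃ h12 h13 h23
  have ha : 0 ≤ (prodBernoulli p).real A := measureReal_nonneg
  have hb : 0 ≤ (prodBernoulli p).real (E₁ ∪ E₂ ∪ E₃)ᶜ := measureReal_nonneg
  rcases hC1 with hLA | hLB
  · nlinarith [hLA, hAG, hb]
  · nlinarith [hLB, hAG, ha]

end LawPencil

end Summit.CriticalPhenomena.PercolationContinuityZ3.Theorems.SunflowerPartition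

end
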